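import Literature.NumberTheory.GaloisCohomology.Howard2004.DualityDatumRestrictedPairingProofs
import HarnessLib

/-!
# Howard 2004, H.4 at `v ∣ p`: the FLIPPED restricted pairing `T/Fil_v × Fil′ → R(1)` of a duality datum and the
# non-degeneracy of its cup product (theorems only; no definition, no named fact, no instance, no `sorry`)

Topic `NumberTheory/GaloisCohomology/Howard2004` (sequel to `DualityDatumRestrictedPairingProofs`; cell `pub/bsd-print-x9`,
brick (B3♭) of `HOME/p1/H4-EXACT-AT-P-PLAN`: the X/Y-flipped twin of (B3) needed for the second (Exact) clause of the
H.4 descent at `v ∣ p`).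

Howard [B. Howard, Compositio Math. 140 (2004), §1.3 H.4 and Lemma 3.1.1, Def. 3.2.6; arXiv:1202.6340 p. 7 L69–82, p. 15 L60–62,
p. 16 L108–110]: at `v ∣ p` the plus part `Fil_v(T_𝔭)` is its own exact orthogonal complement under `e_𝔭` (Lemma 3.1.1), so
`e_𝔭` induces TWO perfect pairings, `Fil_v T × Tw(T)/Fil′ → R(1)` (`DualityDatum.exists_restrictedPairing`, the (B3) file) and
its flip `T/Fil_v × Fil′ → R(1)` (this file), `Fil′` the transported plus part at `v̄`; the cup product of either is
non-degenerate by local Tate duality, and the H.4 descent for the saturated `F_𝔮` (`Tower.pow_smul_eq_zero_of_forall_pairing_eq_zero`,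
both orientations of `Tower.levelCondition_mem_iff_forall_pairing_eq_zero`) consumes both.  For a datum `D : DualityDatum p cd ρ R`,
a finite place `v`, a `Γ_{K_v}`-stable `V ≤ T` and a `Γ_{K_v}`-stable `V′ ≤ Tw(T)` with `D.e(V, V′) = 0`:

* §1 **`DualityDatum.exists_restrictedPairing_flip`** — a continuous equivariant `P♭ : (T/V) × V′ → R(1)|_{Γ_{K_v}}` on the tree's
  carriers `(GaloisRep.toLocal v ρ).quotient V hV`, `(GaloisRep.toLocal v (cd.twist ρ)).subrepresentation V′ hV′` with
  `P♭([s], t) = D.e s t`;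
* §2 **`DualityDatum.exists_mem_forall_reading_eq_of_forall_mem_eq_zero`** — module-level perfectness of the flip is FREE: if the
  `λ`-reading of `D.e` is right non-degenerate on `T` ((hN) `λ e(T, t) = 0 ⇒ t = 0`) and (hR) `{t | λ e(V, t) = 0} ⊆ V′`, then every
  additive `φ : T → ℤ/p^k` vanishing on `V` is `λ e(·, t)` for some `t ∈ V′` (counting, `Nat.card_addMonoidHom_zmod`);
* §3 **`DualityDatum.restrictedPairing_flip_cupProduct_nondegenerate`** (+ the two one-sided forms) — for ANY such `P♭`, under
  (hN), (hR), a reading `λ : R → ℤ/p^k` and `exp : ℤ/p^k ≅ μ_{p^k}` as in `DualityDatumTateDualBridge`, BOTH kernels of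
  `P♭.cupProduct : H¹(K_v, T/V) × H¹(K_v, V′) → H²(K_v, R(1))` are trivial (push to a `μ_{p^k}(K̄_v)`-valued pairing of local
  modules, perfect at the module level, and apply `ContPairing.eq_zero_of_forall_cupProduct_eq_zero_right/left` — the tree's
  PROVED local Tate duality `localDuality_bijective`).

The statements carry `[CharZero (v.adicCompletion K)]` (discharge: `charZero_adicCompletion v`).  Nothing about any curve is
asserted; the Eisenstein/`E`-instance is the next file.  No summit statement is proved; BSD is not proved by any of this.

References: [Howard2004HeegnerKolyvagin] §1.3 H.4, Lemma 2.1.1, Lemma 3.1.1, Def. 3.2.6 (arXiv:1202.6340 p. 7 L69–82, p. 15 L60–62,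
p. 16 L108–110); [MilneADT2006] I §0 (pairings, `M^D`, Prop. 0.19), I Cor. 2.3; [SerreGaloisCohomology1997] II §5.2 Thm. 2;
[NeukirchSchmidtWingberg2008] I §4 (1.4.2); [GreenbergLNM1716] §2 (the ordinary condition `im H¹(F⁺)`).
-/

set_option autoImplicit false

noncomputable section

open CategoryTheory Function NumberField IsDedekindDomain Field
open scoped ContRepresentation NumberField

namespace Literature.NumberTheory.GaloisCohomology.Howard2004

open Literature.NumberTheory.GaloisRepresentations
open Literature.NumberTheory.GaloisRepresentations.DiscreteGaloisModule

variable {K : Type} [Field K] [NumberField K] {M : Type} [AddCommGroup M] [TopologicalSpace M]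
  [DiscreteTopology M] {R : Type} [CommRing R] [Module R M] [TopologicalSpace R] [DiscreteTopology R]
  {p : ℕ} [hp : Fact p.Prime] [Algebra ℤ_[p] R] {cd : ConjugationDatum K} {ρ : DiscreteGaloisModule K M}
  (D : DualityDatum p cd ρ R) (v : HeightOneSpectrum (𝓞 K))
  (V : Submodule ℤ M) (hV : ∀ σ : absoluteGaloisGroup (v.adicCompletion K), V ≤ V.comap (GaloisRep.toLocal v ρ σ))
  (V' : Submodule ℤ M)
  (hV' : ∀ σ : absoluteGaloisGroup (v.adicCompletion K), V' ≤ V'.comap (GaloisRep.toLocal v (cd.twist ρ) σ))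

namespace DualityDatum

/-! ## §1 The flipped restricted pairing `T/V × V′ → R(1)` -/

/-- **The flipped restricted pairing of a duality datum.**  If `D.e(V, V′) = 0` for a `Γ_{K_v}`-stable `V ≤ T` and a
`Γ_{K_v}`-stable `V′ ≤ Tw(T)`, the pairing `e : T × Tw(T) → R(1)` descends to a continuous `Γ_{K_v}`-equivariant pairing
`P♭ : (T/V) × V′ → R(1)|_{Γ_{K_v}}` on the tree's carriers (`ContinuousRep.quotient`, `ContinuousRep.subrepresentation`) with
`P♭([s], t) = e(s, t)` — Howard's `e_𝔭` restricted to `T_𝔭/Fil_v T_𝔭 × Fil′` (the twin of `exists_restrictedPairing`).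
[cite: Howard2004HeegnerKolyvagin, §1.3 H.4 and Lemma 3.1.1 (arXiv p. 7 L69–82, p. 15 L60–62)] [cite: MilneADT2006, I §0] -/
theorem exists_restrictedPairing_flip (horth : ∀ s ∈ V, ∀ t ∈ V', D.e s t = 0) :
    ∃ P : ContPairing ((GaloisRep.toLocal v ρ).quotient V hV).toTopRep
        ((GaloisRep.toLocal v (cd.twist ρ)).subrepresentation V' hV').toTopRep (GaloisRep.toLocal v D.twistOne).toTopRep,
      ∀ (s : M) (t : V'), P.toLin (Submodule.Quotient.mk s) t = D.e s (t : M) := by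
  -- `s ↦ e(s, ·)|_{V′}` as a `ℤ`-bilinear map `M → V′ → R`
  let L : M →ₗ[ℤ] V' →ₗ[ℤ] R :=
    { toFun := fun s ↦ (D.e s).toAddMonoidHom.toIntLinearMap.domRestrict V'
      map_add' := fun s s' ↦ LinearMap.ext fun t ↦ by
        change D.e (s + s') (t : M) = D.e s (t : M) + D.e s' (t : M)
        rw [map_add, LinearMap.add_apply]
      map_smul' := fun c s ↦ LinearMap.ext fun t ↦ by
        rw [RingHom.id_apply, LinearMap.smul_apply]
        change D.e (c • s) (t : M) = c • D.e s (t : M)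
        rw [← LinearMap.flip_apply D.e, map_zsmul, LinearMap.flip_apply] }
  have hL : ∀ (s : M) (t : V'), L s t = D.e s (t : M) := fun s t ↦ rfl
  -- it kills `V`, so descends to `M ⧸ V`
  let B : (M ⧸ V) →ₗ[ℤ] V' →ₗ[ℤ] R :=
    V.liftQ L fun s hs ↦ by
      rw [LinearMap.mem_ker]
      refine LinearMap.ext fun t ↦ ?_
      rw [hL, LinearMap.zero_apply]
      exact horth s hs t t.2
  have hB : ∀ (s : M) (t : V'), B (Submodule.Quotient.mk s) t = D.e s (t : M) := fun s t ↦ rfl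
  refine ⟨ContPairing.ofDiscrete B fun σ q t ↦ ?_, fun s t ↦ rfl⟩
  induction q using Submodule.Quotient.induction_on with
  | _ s =>
    change B ((GaloisRep.toLocal v ρ).quotient V hV σ (Submodule.Quotient.mk s))
        ⟨GaloisRep.toLocal v (cd.twist ρ) σ (t : M), _⟩ =
      GaloisRep.toLocal v D.twistOne σ (B (Submodule.Quotient.mk s) t)
    rw [ContinuousRep.quotient_apply_mk, hB, hB]
    exact D.eHom_equivariant (absGaloisRestrict K _ σ) s (t : M)

/-! ## §2 Module-level perfectness of the flip is free -/

section Reading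

variable {D V V'} {k : ℕ} (lam : R →+ ZMod (p ^ k))
  (hN : ∀ t : M, (∀ s : M, lam (D.e s t) = 0) → t = 0)
  (hR : ∀ t : M, (∀ s ∈ V, lam (D.e s t) = 0) → t ∈ V')

include hN in
/-- **Every additive `T → ℤ/p^k` is a `λ`-reading `λ e(·, t)`** when `λ ∘ e` is right non-degenerate on the finite
`p^k`-torsion `T`: the map `t ↦ λ e(·, t)`, `T → Hom(T, ℤ/p^k)`, is injective between groups of the same order
(`Nat.card_addMonoidHom_zmod`), hence onto. [cite: MilneADT2006, I §0 Prop. 0.19 (finite duality)]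
[cite: Howard2004HeegnerKolyvagin, §2.1 (Hom_{S_𝔭}(N, 𝒟_𝔭(1)) ≅ Hom(N, μ_{p^∞}))] -/
theorem exists_forall_reading_eq [Finite M] (hM : ∀ m : M, (p ^ k) • m = 0) (φ : M →+ ZMod (p ^ k)) :
    ∃ t : M, ∀ s : M, lam (D.e s t) = φ s := by
  haveI : NeZero (p ^ k) := ⟨pow_ne_zero k hp.out.ne_zero⟩
  -- `t ↦ λ e(·, t)`
  let Ψ : M → (M →+ ZMod (p ^ k)) := fun t ↦ lam.comp (D.e.flip t).toAddMonoidHom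
  have hΨ : ∀ t s : M, Ψ t s = lam (D.e s t) := fun t s ↦ rfl
  have hinj : Injective Ψ := fun t t' h ↦ by
    rw [← sub_eq_zero]
    refine hN _ fun s ↦ ?_
    rw [map_sub, map_sub, ← hΨ t s, ← hΨ t' s, h, sub_self]
  have hcard : Nat.card (M →+ ZMod (p ^ k)) = Nat.card M := Nat.card_addMonoidHom_zmod hM
  haveI : Finite (M →+ ZMod (p ^ k)) := Nat.finite_of_card_ne_zero (by rw [hcard]; exact Nat.card_pos.ne')
  obtain ⟨t, ht⟩ := (hinj.bijective_of_nat_card_le hcard.le).2 φ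
  exact ⟨t, fun s ↦ by rw [← hΨ, ht]⟩

include hN hR in
/-- **Module-level perfectness of the flipped restricted pairing** `T/V × V′ → ℤ/p^k` (read through `λ`): if `λ ∘ e` is right
non-degenerate on `T` ((hN)) and `{t | λ e(V, t) = 0} ⊆ V′` ((hR) — `Fil_v^⊥ ⊆ Fil′`, Howard's Lemma 3.1.1), then every additive
`φ : T → ℤ/p^k` vanishing on `V` is `λ e(·, t)` for some `t ∈ V′`.
[cite: Howard2004HeegnerKolyvagin, Lemma 3.1.1 (arXiv p. 15 L60–62)] [cite: MilneADT2006, I §0 Prop. 0.19] -/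
theorem exists_mem_forall_reading_eq_of_forall_mem_eq_zero [Finite M] (hM : ∀ m : M, (p ^ k) • m = 0)
    (φ : M →+ ZMod (p ^ k)) (hφ : ∀ s ∈ V, φ s = 0) : ∃ t ∈ V', ∀ s : M, lam (D.e s t) = φ s := by
  obtain ⟨t, ht⟩ := exists_forall_reading_eq lam hN hM φ
  exact ⟨t, hR t fun s hs ↦ by rw [ht, hφ s hs], ht⟩

end Reading

/-! ## §3 Non-degeneracy of the cup product of the flipped restricted pairing -/

section Nondegenerate

variable {D v V hV V' hV'} [CharZero (v.adicCompletion K)] {k : ℕ}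
  (lam : R →+ ZMod (p ^ k))
  (hlam : ∀ (z : ℤ_[p]) (r : R), lam (algebraMap ℤ_[p] R z * r) = PadicInt.toZModPow k z * lam r)
  (exp : ZMod (p ^ k) →+ MuCarrier K (p ^ k))
  (hexp : ∀ (g : absoluteGaloisGroup K) (x : ZMod (p ^ k)),
    exp (cyclotomicCharacterModPow K p k g * x) = mu K (p ^ k) g (exp x))
  (hexpb : Bijective exp)
  (P : ContPairing ((GaloisRep.toLocal v ρ).quotient V hV).toTopRep
    ((GaloisRep.toLocal v (cd.twist ρ)).subrepresentation V' hV').toTopRep (GaloisRep.toLocal v D.twistOne).toTopRep)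
  (hP : ∀ (s : M) (t : V'), P.toLin (Submodule.Quotient.mk s) t = D.e s (t : M))
  (hM : ∀ m : M, (p ^ k) • m = 0)
  (hN : ∀ t : M, (∀ s : M, lam (D.e s t) = 0) → t = 0)
  (hR : ∀ t : M, (∀ s ∈ V, lam (D.e s t) = 0) → t ∈ V')

include hlam hexp hP hM hN hR hexpb in
/-- **The `μ_{p^k}(K̄_v)`-valued push of the flipped restricted pairing is perfect at the module level** (auxiliary packaging of
(hN)/(hR) after `exp ∘ λ` and `μ_{p^k}(K̄) ≅ μ_{p^k}(K̄_v)`): there is a continuous equivariant `P′ : (T/V) × V′ → μ_{p^k}(K̄_v)`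
with `P′.cupProduct = H²(exp ∘ λ, transfer) ∘ P♭.cupProduct`, trivial right kernel and every additive `T/V → μ` represented.
[cite: Howard2004HeegnerKolyvagin, §1.3 H.4 and §2.1 (Hom_{S_𝔭}(N, 𝒟_𝔭(1)) ≅ Hom(N, μ_{p^∞}))] [cite: MilneADT2006, I §0] -/
theorem exists_muPairing_restricted_flip [Finite M] :
    letI : NeZero (p ^ k) := ⟨pow_ne_zero k hp.out.ne_zero⟩
    ∃ (P' : ContPairing ((GaloisRep.toLocal v ρ).quotient V hV).toTopRep
        ((GaloisRep.toLocal v (cd.twist ρ)).subrepresentation V' hV').toTopRep (mu (v.adicCompletion K) (p ^ k)).toTopRep)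
      (γ : (GaloisRep.toLocal v D.twistOne).toTopRep ⟶ (mu (v.adicCompletion K) (p ^ k)).toTopRep),
      (∀ x y, cohomologyMap γ 2 (P.cupProduct x y) = P'.cupProduct x y) ∧
      (∀ b, (∀ a, P'.toLin a b = 0) → b = 0) ∧
      (∀ f : (M ⧸ V) →+ MuCarrier (v.adicCompletion K) (p ^ k), ∃ b, ∀ a, P'.toLin a b = f a) := by
  haveI : NeZero (p ^ k) := ⟨pow_ne_zero k hp.out.ne_zero⟩
  -- the value map `R(1)|_v → μ(K̄) → μ(K̄_v)`, `r ↦ transfer (exp (λ r))`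
  let γ₀ : R →+ MuCarrier (v.adicCompletion K) (p ^ k) :=
    (muTransfer K (v.adicCompletion K) (p ^ k)).comp (D.expLam lam exp)
  let γ : (GaloisRep.toLocal v D.twistOne).toTopRep ⟶ (mu (v.adicCompletion K) (p ^ k)).toTopRep :=
    TopRep.ofHom
      { toContinuousLinearMap := ⟨γ₀.toIntLinearMap, continuous_of_discreteTopology⟩
        isIntertwining' := fun σ ↦ ContinuousLinearMap.ext fun r ↦ by
          change γ₀ (D.twistOne (absGaloisRestrict K (v.adicCompletion K) σ) r) = mu (v.adicCompletion K) (p ^ k) σ (γ₀ r)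
          change muTransfer K (v.adicCompletion K) (p ^ k) (D.expLam lam exp (D.twistOne _ r)) =
            mu (v.adicCompletion K) (p ^ k) σ (muTransfer K (v.adicCompletion K) (p ^ k) (D.expLam lam exp r))
          rw [D.expLam_twistOne lam hlam exp hexp, muTransfer_mu] }
  have hγ : ∀ r : R, γ.hom r = muTransfer K (v.adicCompletion K) (p ^ k) (exp (lam r)) := fun r ↦ rfl
  -- the pushed pairing
  let P' : ContPairing ((GaloisRep.toLocal v ρ).quotient V hV).toTopRep
      ((GaloisRep.toLocal v (cd.twist ρ)).subrepresentation V' hV').toTopRep (mu (v.adicCompletion K) (p ^ k)).toTopRep :=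
    ContPairing.ofDiscrete (P.toLin.compr₂ γ.hom.toContinuousLinearMap.toLinearMap) fun σ a b ↦ by
      rw [LinearMap.compr₂_apply, LinearMap.compr₂_apply, P.toLin_smul]
      exact ContinuousRep.hom_comm_apply γ σ _
  have hP' : ∀ a b, P'.toLin a b = γ.hom (P.toLin a b) := fun a b ↦ rfl
  refine ⟨P', γ, fun x y ↦ ?_, fun b hb ↦ ?_, fun f ↦ ?_⟩
  · -- cup products
    have h := ContPairing.cupProduct_map P P' (𝟙 _) (𝟙 _) γ (fun a b ↦ rfl) x y
    have hx : cohomologyMap (𝟙 ((GaloisRep.toLocal v ρ).quotient V hV).toTopRep) 1 x = x := by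
      rw [show cohomologyMap (𝟙 ((GaloisRep.toLocal v ρ).quotient V hV).toTopRep) 1 = 𝟙 _ from
        ContinuousCohomology.map_id _ _]; rfl
    have hy : cohomologyMap (𝟙 ((GaloisRep.toLocal v (cd.twist ρ)).subrepresentation V' hV').toTopRep) 1 y = y := by
      rw [show cohomologyMap (𝟙 ((GaloisRep.toLocal v (cd.twist ρ)).subrepresentation V' hV').toTopRep) 1 = 𝟙 _ from
        ContinuousCohomology.map_id _ _]; rfl
    rw [hx, hy] at h
    exact h
  · -- right kernel: `λ e(s, b) = 0` for all `s`, so `b = 0` by (hN)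
    refine Subtype.ext (hN (b : M) fun s ↦ ?_)
    have h0 := hb (Submodule.Quotient.mk s)
    rw [hP', hP, hγ] at h0
    have h1 : exp (lam (D.e s (b : M))) = 0 :=
      muTransfer_injective K (v.adicCompletion K) (p ^ k) (by rw [h0, map_zero])
    exact hexpb.1 (by rw [h1, map_zero])
  · -- every additive `T/V → μ(K̄_v)` is represented by some `t ∈ V′` (§2)
    let E : ZMod (p ^ k) ≃+ MuCarrier (v.adicCompletion K) (p ^ k) :=
      (AddEquiv.ofBijective exp hexpb).trans (muTransferEquiv K (v.adicCompletion K) (p ^ k))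
    have hE : ∀ x, E x = muTransfer K (v.adicCompletion K) (p ^ k) (exp x) := fun x ↦ rfl
    obtain ⟨t, htV', ht⟩ := exists_mem_forall_reading_eq_of_forall_mem_eq_zero lam hN hR hM
      (E.symm.toAddMonoidHom.comp (f.comp (Submodule.mkQ V).toAddMonoidHom)) fun s hs ↦ by
        rw [AddMonoidHom.comp_apply, AddMonoidHom.comp_apply, LinearMap.toAddMonoidHom_coe, Submodule.mkQ_apply,
          (Submodule.Quotient.mk_eq_zero V).mpr hs, map_zero, map_zero]
    refine ⟨⟨t, htV'⟩, fun a ↦ ?_⟩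
    induction a using Submodule.Quotient.induction_on with
    | _ s =>
      rw [hP', hP, hγ, ht, ← hE]
      exact E.apply_symm_apply _

include hP hM hN hR hexpb hlam hexp in
/-- **Right non-degeneracy of the cup product of the flipped restricted pairing** `H¹(K_v, T/V) × H¹(K_v, V′) → H²(K_v, R(1))`:
if `P♭(x, y) = 0` for all `x ∈ H¹(K_v, T/V)` then `y = 0` in `H¹(K_v, V′)` — the flipped (Nondeg′) input at `v ∣ p` of the
H.4 descent for the saturated ordinary condition (`V = Fil_v T`, `V′ =` the transport of `Fil_v̄ T`).
[cite: Howard2004HeegnerKolyvagin, §1.3 H.4, Lemma 3.1.1 and Def. 3.2.6 (arXiv p. 7 L78–82, p. 15 L60–62, p. 16 L108–110)]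
[cite: MilneADT2006, I Cor. 2.3] [cite: SerreGaloisCohomology1997, II §5.2 Thm. 2] -/
theorem restrictedPairing_flip_eq_zero_of_forall_cupProduct_eq_zero_right [Finite M]
    (y : galoisCohomology ((GaloisRep.toLocal v (cd.twist ρ)).subrepresentation V' hV') 1)
    (hy : ∀ x : galoisCohomology ((GaloisRep.toLocal v ρ).quotient V hV) 1, P.cupProduct x y = 0) : y = 0 := by
  haveI : NeZero (p ^ k) := ⟨pow_ne_zero k hp.out.ne_zero⟩
  obtain ⟨P', γ, hcup, hinj, hsurj⟩ := exists_muPairing_restricted_flip lam hlam exp hexp hexpb P hP hM hN hR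
  refine ContPairing.eq_zero_of_forall_cupProduct_eq_zero_right (v.adicCompletion K)
    ((GaloisRep.toLocal v ρ).quotient V hV) ((GaloisRep.toLocal v (cd.twist ρ)).subrepresentation V' hV') P'
    (fun a ↦ ?_) hinj hsurj y fun x ↦ ?_
  · induction a using Submodule.Quotient.induction_on with
    | _ s => rw [← Submodule.mkQ_apply, ← map_nsmul, hM, map_zero]
  have h := hcup x y
  rw [hy, map_zero] at h
  exact h.symm

include hP hM hN hR hexpb hlam hexp in
/-- **Left non-degeneracy of the cup product of the flipped restricted pairing**: if `P♭(x, y) = 0` for all `y ∈ H¹(K_v, V′)`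
then `x = 0` in `H¹(K_v, T/V)`. [cite: Howard2004HeegnerKolyvagin, §1.3 H.4, Lemma 3.1.1 and Def. 3.2.6 (arXiv p. 7 L78–82, p. 15 L60–62)]
[cite: MilneADT2006, I Cor. 2.3] [cite: SerreGaloisCohomology1997, II §5.2 Thm. 2] -/
theorem restrictedPairing_flip_eq_zero_of_forall_cupProduct_eq_zero_left [Finite M]
    (x : galoisCohomology ((GaloisRep.toLocal v ρ).quotient V hV) 1)
    (hx : ∀ y : galoisCohomology ((GaloisRep.toLocal v (cd.twist ρ)).subrepresentation V' hV') 1, P.cupProduct x y = 0) :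
    x = 0 := by
  haveI : NeZero (p ^ k) := ⟨pow_ne_zero k hp.out.ne_zero⟩
  obtain ⟨P', γ, hcup, hinj, hsurj⟩ := exists_muPairing_restricted_flip lam hlam exp hexp hexpb P hP hM hN hR
  refine ContPairing.eq_zero_of_forall_cupProduct_eq_zero_left (v.adicCompletion K)
    ((GaloisRep.toLocal v ρ).quotient V hV) ((GaloisRep.toLocal v (cd.twist ρ)).subrepresentation V' hV') P'
    (fun a ↦ ?_) hinj hsurj x fun y ↦ ?_
  · induction a using Submodule.Quotient.induction_on with
    | _ s => rw [← Submodule.mkQ_apply, ← map_nsmul, hM, map_zero]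
  have h := hcup x y
  rw [hx, map_zero] at h
  exact h.symm

include hP hM hN hR hexpb hlam hexp in
/-- **Both kernels of the cup product of the flipped restricted pairing are trivial** — the hypothesis shape (Nondeg′)/(Nondeg)
of the tree's limit statements `Tower.pow_smul_eq_zero_of_forall_pairing_eq_zero` / `…_of_range` for the flipped pair of local
towers `H¹(K_v, (T/p^j)/Fil_v) × H¹(K_v, Fil′(T/p^j))`. [cite: Howard2004HeegnerKolyvagin, §1.3 H.4 and Def. 3.2.6 (arXiv p. 7 L78–82, p. 16 L108–110)]
[cite: MilneADT2006, I Cor. 2.3] -/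
theorem restrictedPairing_flip_cupProduct_nondegenerate [Finite M] :
    (∀ x : galoisCohomology ((GaloisRep.toLocal v ρ).quotient V hV) 1,
        (∀ y : galoisCohomology ((GaloisRep.toLocal v (cd.twist ρ)).subrepresentation V' hV') 1, P.cupProduct x y = 0) →
          x = 0) ∧
      ∀ y : galoisCohomology ((GaloisRep.toLocal v (cd.twist ρ)).subrepresentation V' hV') 1,
        (∀ x : galoisCohomology ((GaloisRep.toLocal v ρ).quotient V hV) 1, P.cupProduct x y = 0) → y = 0 :=
  ⟨fun x hx ↦ restrictedPairing_flip_eq_zero_of_forall_cupProduct_eq_zero_left lam hlam exp hexp hexpb P hP hM hN hR x hx,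
    fun y hy ↦ restrictedPairing_flip_eq_zero_of_forall_cupProduct_eq_zero_right lam hlam exp hexp hexpb P hP hM hN hR y hy⟩

end Nondegenerate

end DualityDatum

end Literature.NumberTheory.GaloisCohomology.Howard2004

end
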